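import Summits.QuantumFields.YangMills.Theorems.FlatTubeReductionProfileDressingPackageR
import Summits.QuantumFields.YangMills.Theorems.LuscherReductionTwistedTraceScalingBODefectCoreNorm
import HarnessLib

/-!
# THE WEIGHTED NORM OF A BO FUNCTION OF RECORD FROM BELOW, AT THE RATE TWIN'S SCALES: `½·γ_β·‖φ‖²₂ ≤ ‖φ⊗Ω_c‖²_w` for `φ` supported in the scaled window
# `{orbitDist < D·recordDelta1 L (1/6) β}`, weight `softWeight (recordChi L (1/6) (42D+1) M β)`, profile `Ω_c = recordProfile L` — input (3) of the (B-OD) currency for `stub_hODpot_A`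
# (route `FlatTubeReduction`, crux K1 `NearFlatRatioLaw` stmt-QuantumFields-24720; seat `ym-line-ftr-p1` g17; rate twin «ratepack-v6»; R2b1 RECORD rung — no summit statement is proved here)

WHY (crux workfile `Lines/ratepack-v6-port-g17.md` §6).  Lane A's `…BORecordGamma.tubeNormSq_record_ge` (window `14β^{-s}/|Site|`, `K = 43`, constant `1 − C_P(43β^{-s})²`) converts
`∫φ²` into the hOD currency `T(φ⊗Ω_c) = tubeNormSq w (boFun φ Ω_c)` in `…BODefectCoreCurrency`.  The rate twin's assembly of `stub_hODpot_A` needs the same at `(s,K) = (1/6, 42D+1)`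
on the scaled window; instead of porting the fat-tube geometry, the floor follows from the rate twin's own pointwise (B-N) brick `…FibreMassPointwiseRecordR.fibreMass_pointwise_record_R`
(`|mass_β(u) − γ_β| ≤ (κ_N·d(u)² + aλ_b²)·γ_β` on the window, so `mass_β(u) ≥ ½γ_β` eventually) and lane A's abstract `…BODefectCoreNorm.tubeNormSq_boFun_ge`.
  ★★ `tubeNormSq_record_ge_R` — `∃ M₀ ≥ 2, ∀ M ≥ M₀, ∀ᶠ β, ∀ φ` (measurable, bounded, supported in the scaled window):
  `½·recordGamma L (recordProfile L) β·∫φ² ≤ tubeNormSq (softWeight (recordChi L (1/6) (42D+1) M β)) (boFun φ (recordProfile L β))` (`D ≥ 0`).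
HONEST FRAMING: bookkeeping; femto rung R2b1 (RECORD label); not infinite volume, not a gap, not Clay.  No defs, no named facts, no `sorry`.
-/

set_option autoImplicit false

noncomputable section

open MeasureTheory Filter Topology Real
open scoped BigOperators
open Literature.MathematicalPhysics.QuantumFieldTheory
open Literature.MathematicalPhysics.QuantumLattice

namespace Summit.QuantumFields.YangMills.Theorems.FemtoTransferGap.RateTube

open Summit.QuantumFields.YangMills.Theorems.FemtoTransferGap
open Summit.QuantumFields.YangMills.Theorems.FemtoTransferGap.TwoLattice
open Summit.QuantumFields.YangMills.Theorems.FemtoTransferGap.TwoLattice.ConstTube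
open Summit.QuantumFields.YangMills.Theorems.FemtoTransferGap.TwoLattice.Avg
open Summit.QuantumFields.YangMills.Theorems.FemtoTransferGap.TwoLattice.Stiff (LinkSpace)

variable {L : ℕ} [NeZero L]

/-- ★★ **`‖φ⊗Ω_c‖²_w ≥ ½·γ·‖φ‖²₂` AT THE RATE TWIN'S SCALES.**  `D ≥ 0`; there is `M₀ ≥ 2` such that for every `M ≥ M₀`, eventually in `β`, for every bounded measurable `φ`
supported in `{orbitDist u < D·recordDelta1 L (1/6) β}`:
`½·recordGamma L (recordProfile L) β·∫φ² ≤ tubeNormSq (softWeight (recordChi L (1/6) (42D+1) M β)) (boFun L φ (recordProfile L β))`. [cite: Luscher1983, §3] -/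
theorem tubeNormSq_record_ge_R (hL : Nonempty (NzSite L)) {D : ℝ} (hD : 0 ≤ D) :
    ∃ M₀ : ℝ, 2 ≤ M₀ ∧ ∀ M : ℝ, M₀ ≤ M → ∀ᶠ β : ℝ in atTop, ∀ φ : GaugeConfig 3 1 SU2 → ℝ, Measurable φ → ∀ Cφ : ℝ, (∀ u, |φ u| ≤ Cφ) →
      (∀ u, φ u ≠ 0 → orbitDist u < D * recordDelta1 L (1 / 6) β) →
      1 / 2 * recordGamma L (recordProfile L) β * ∫ u, φ u ^ 2 ∂configMeasure SU2 1 ≤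
        tubeNormSq (softWeight (recordChi L (1 / 6) (42 * D + 1) M β)) (boFun L φ (recordProfile L β)) := by
  obtain ⟨hΩm, hΩ01, hCΩ, -⟩ := recordProfile_fields L
  obtain ⟨hR0, hRsmall, hR1⟩ := recordRadius_eventually (L := L)
  obtain ⟨M₀, hM₀, hrec⟩ := fibreMass_pointwise_record_R hL hD hΩm hCΩ (fun β x hx => norm_le_of_recordProfile_ne_zero L hx) hR0 hRsmall hR1
  refine ⟨M₀, hM₀, fun M hM => ?_⟩
  obtain ⟨κN, a, β₀, hκN, ha, hrecβ⟩ := hrec M hM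
  -- smallness: `κ_N·(Dδ₁)² ≤ 1/4`, `aλ_b² ≤ 1/4`
  have hδt : Tendsto (fun β : ℝ => D * recordDelta1 L (1 / 6) β) atTop (𝓝 0) := by
    simpa using (tendsto_recordDelta1 (L := L) (by norm_num : (0 : ℝ) < 1 / 6)).const_mul D
  have hδ2 : ∀ᶠ β : ℝ in atTop, κN * (D * recordDelta1 L (1 / 6) β) ^ 2 ≤ 1 / 4 := by
    have h := (hδt.pow 2).const_mul κN
    rw [zero_pow two_ne_zero, mul_zero] at h
    exact h.eventually (eventually_le_nhds (by norm_num))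
  filter_upwards [Filter.eventually_ge_atTop β₀, hδ2, mul_bareLambda_sq_eventually_le (L := L) ha, Filter.eventually_ge_atTop (0 : ℝ)] with β hβ₀ hκδ hal hβ0 φ hφm Cφ hCφ hφs
  obtain ⟨hwm, hwb, -, -⟩ := softWeight_recordChi_props (L := L) (1 / 6) (42 * D + 1) M β
  have hγ0 : 0 ≤ recordGamma L (recordProfile L) β := (recordGamma_recordProfile_pos L hβ0).le
  -- the fibre-mass floor `γ/2` on the window
  have hΓ : ∀ u ∈ {u : GaugeConfig 3 1 SU2 | orbitDist u < D * recordDelta1 L (1 / 6) β},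
      1 / 2 * recordGamma L (recordProfile L) β ≤ fibreMass L (softWeight (recordChi L (1 / 6) (42 * D + 1) M β)) (recordProfile L β) u := by
    intro u hu
    have hu' : orbitDist u ≤ D * recordDelta1 L (1 / 6) β := le_of_lt hu
    obtain ⟨hb, -⟩ := hrecβ β hβ₀ u hu'
    have hd2 : orbitDist u ^ 2 ≤ (D * recordDelta1 L (1 / 6) β) ^ 2 := pow_le_pow_left₀ (orbitDist_nonneg u) hu' 2
    have hsmall : κN * orbitDist u ^ 2 + a * bareLambda ((L : ℝ) ^ 3 * β) ^ 2 ≤ 1 / 2 := by nlinarith [mul_le_mul_of_nonneg_left hd2 hκN]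
    have h1 := (abs_le.mp hb).1
    nlinarith [mul_le_mul_of_nonneg_right hsmall hγ0]
  exact tubeNormSq_boFun_ge (L := L) hφm hCφ (hΩm β) (hCΩ β) hwm hwb (𝒰 := {u : GaugeConfig 3 1 SU2 | orbitDist u < D * recordDelta1 L (1 / 6) β}) (fun u hu => hφs u hu) hΓ

end Summit.QuantumFields.YangMills.Theorems.FemtoTransferGap.RateTube

end
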